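import Summits.ABC.Harvest.GlueShimura
import Literature.NumberTheory.EllipticCurves.PastenValuationProduct
import Literature.NumberTheory.EllipticCurves.PastenValuationProductSemistableProofs
import Literature.NumberTheory.DiophantineGeometry.PastenValuationProductsProofs
import HarnessLib

/-!
# ABC harvest 2015–2026: the Shimura door and the modular-degree door are ONE WALL on semistable curves (glue G-28)

`Summits/ABC/Harvest/GlueShimuraModdeg.lean` — cell `abc-harv` (C3), seat `abc-harv-typ-1` (KEY G28-SHIMURA-MODDEG),
namespace `Summit.ABC.Harvest`. §GLUE LEDGER **G-28** of the cell's table of record (director-abc g7-D2 (2): the TYPED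
OBSTRUCTION «SHIMURA door ≡ MODDEG door at A-PS strength, loss `11/2 + ε` in `K`», certified as ONE glue theorem — not a
route, not a bridge). Two proof-free `Prop`s (restrictions of the typed door `Summit.ABC.Harvest.ModularDegreeConjecture`,
Pasten 2024 Conj. 3.2, to the classes of curves on which print controls `∏_{p∣D} v_p(Δ_E)`) and SORRY-FREE glue:

* `ModularDegreeConjectureSemistable` = Conj. 3.2 restricted to semistable `E/ℚ` (binder `W.IsSemistable ℤ →`);
* `ModularDegreeConjectureAwayFrom S` = Conj. 3.2 restricted to `E/ℚ` semistable away from the finite set `S` with at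
  least two multiplicative primes (the hypotheses of Pasten's Cor. 16.2, in the rendering of
  `Literature.NumberTheory.DiophantineGeometry.pasten_valuationProduct_awayFrom`);
* **`modularDegreeConjectureSemistable_of_shimuraDegreeConjecture (h61) (h112) : ShimuraDegreeConjecture →
  ModularDegreeConjectureSemistable`** (G-28) and `modularDegreeConjectureAwayFrom_of_shimuraDegreeConjecture (h61)
  (h162) (S)`, each with an EFFECTIVE form printing the loss **`K ↦ K + 11/2 + ε`** (every `ε > 0`):
  `exists_log_modularDegree_le_of_shimuraDegree_semistable` / `…_awayFrom`.

The chain is Pasten's (EqUpperRT) = Thm 6.1 "In particular" [p. 20]: `log δ_{1,N} ≤ log δ_{D,M} + log ∏_{p∣D} v_p(Δ_E)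
+ ω(D)·log 163` (tree: `PastenShimura2024_thm_6_1.log_le`, PROVED from the named fact `h61 =
Literature.NumberTheory.Automorphic.PastenShimura2024_thm_6_1`, numerator of `γ_{D,M,E}` at most `163^{ω(D)}`), closed by
(i) `∏_{p∣D} v_p(Δ_E) ≤ ∏_{p ∥ N_E} v_p(Δ_E) ≤ ∏_{p∣N_E} v_p(Δ_E)` (every `p ∣ D` divides `N_E` exactly once, `D`
squarefree and coprime to `M`; every `v_p(Δ_E) ≥ 1` on `p ∣ N_E` as `N_E ∣ Δ_min`), (ii) Pasten's Thm 1.12 [arXiv v4 p. 8 =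
Thm 16.5 p. 50] `∏_{p∣N_E} v_p(Δ_E) < K_ε N_E^{11/2+ε}` for semistable `E` (`h112`; only its FIRST display is used, through
`Literature.NumberTheory.DiophantineGeometry.pasten_valuationProduct_semistable`), resp. Cor. 16.2 [p. 49]
`∏_{p∣N_E^*} v_p(Δ_E) ≪_{S,ε} N_E^{11/2+ε}` for `E` semistable away from `S` with `≥ 2` multiplicative primes (`h162 =
pasten_cor_16_2`, through the tree-PROVED identification `pasten_cor_16_2_iff_pasten_valuationProduct_awayFrom`), and
(iii) `ω(D)·log 163 ≤ η·log N_E + O_η(1)` from `ω(D)! ≤ D ≤ N_E` (`mul_natCast_le_mul_log_of_factorial_le`, via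
`k log k ≤ k + log k!`, the tree's `natCast_mul_log_le_of_pow_div_factorial`).
Per curve (`log_modularDegree_le_of_log_shimuraDegree_le`): `log δ_{1,N}(E) ≤ log δ_{D,M}(E) + log V + η log N_E +
5.1·e^{5.1/η+1}` whenever `∏_{p∣D} v_p(Δ_E) ≤ V`. The `∏ v_p` factor is the ONLY place where the class of `E` enters:
additive places are exactly where print does not control it, so the all-`E` statement `ShimuraDegreeConjecture →
ModularDegreeConjecture` is NOT claimed. With the tree's converse `shimuraDegreeConjecture_of_modularDegreeConjecture
(hmod)` (`GlueShimura.lean`, the `D = 1` instance) this CERTIFIES: door C3 (SHIMURA, census O-66) and the MODDEG door are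
the SAME WALL at rung A-PS on semistable curves (and on curves semistable away from any fixed `S` with two multiplicative
primes, e.g. Frey–Hellegouarch curves, `S = {2}`), with loss `K ↦ K + 11/2 + ε`.

HONESTY LINE (D-0139/D-0140): abc is not proved by any of this; A-PS is NOT abc — «NOT abc — POLY-SZPIRO(E)» (the two
doors reach `Summit.ABC.PolySzpiroRat` by G-06/G-07/G-09); PROVED-MOD-FACTS ≠ proved; typed ≠ proved; the conjectures are
hypotheses or conclusions, never asserted; no side taken on [IUTchIII] Cor 3.12. No `sorry`, no axiom, no `instance`, no
notation, no Literature fact.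
-/

noncomputable section

namespace Summit.ABC.Harvest

open WeierstrassCurve
open Literature.NumberTheory.EllipticCurves
open Literature.NumberTheory.EllipticCurves.ModularForms
open Literature.NumberTheory.DiophantineGeometry (card_factorial_le_prod valuationProduct_def
  pasten_valuationProduct_semistable pasten_valuationProduct_awayFrom
  pasten_valuationProduct_semistable_of_pasten_thm_1_12)
open Literature.NumberTheory.Automorphic
open scoped Nat

/-! ## The two restricted doors (proof-free `Prop`s) -/

/-- **The modular degree conjecture on SEMISTABLE curves** = `Summit.ABC.Harvest.ModularDegreeConjecture` (Pasten 2024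
Conj. 3.2 "As `E` varies over elliptic curves over `ℚ`, we have `log δ_{1,N}(E) ≪ log N_E`", `OpenQuestions.lean` §2)
VERBATIM with the one extra binder `W.IsSemistable ℤ →`: there are `K, C` such that for every SEMISTABLE elliptic `W/ℚ`
of conductor `N` and every parametrisation datum `D` of `W` at level `N` of minimal degree among all data with the same
newform (the tree's idiom for `δ_{1,N}(E) = m_f`), `log D.modularDegree ≤ K · log N + C`. OPEN (record `log m_f ≤ (1/5) N
log N`, `MurtyPasten.log_modularDegree_le`). NOT a restatement of the A0-strength route items
`Summit.ABC.ABC.Theses.IsogenyGlueCongruence.SemistableDegreeConjecture` / `…QuaternionicDegree.…` (FIXED exponent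
`2 + ε`, `∃`-datum idiom): here the exponent is free (rung A-PS). Typed only as the honest target of glue G-28:
`ShimuraDegreeConjecture ⟹` THIS (`modularDegreeConjectureSemistable_of_shimuraDegreeConjecture`, modulo Pasten's Thm 6.1
and Thm 1.12); `ModularDegreeConjecture ⟹ ShimuraDegreeConjecture` holds for all `E` (`GlueShimura.lean`, modulo
modularity) and `ModularDegreeConjecture ⟹` THIS is trivial. CALIBRATION (R2; legend in `OpenQuestions.lean`): the
floors of `ModularDegreeConjecture` are attained at a SEMISTABLE curve (279366b1 = `2·3·101·461`: `C = 0 ⇒ K ≥ 2.1776`,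
`C = 5 ⇒ K ≥ 1.7788`, j285537), so they are floors here verbatim; computed ≠ proved; a calibration bounds constants from
BELOW only. «NOT abc — POLY-SZPIRO(E)» (via G-06/G-07 on semistable `E`). [cite: PastenShimura2024, Conj. 3.2 (§3, p. 13)] [status: open] -/
@[conjecture] def ModularDegreeConjectureSemistable : Prop :=
  ∃ K C : ℝ, ∀ (W : WeierstrassCurve ℚ) [W.IsElliptic] (N : ℕ) [NeZero N]
    (D : ModularParametrizationData W N), W.conductorNorm ℤ = N → W.IsSemistable ℤ →
    (∀ (W' : WeierstrassCurve ℚ) [W'.IsElliptic] (D' : ModularParametrizationData W' N),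
        D'.f = D.f → D.modularDegree ≤ D'.modularDegree) →
      Real.log (D.modularDegree : ℝ) ≤ K * Real.log (N : ℝ) + C

/-- **The modular degree conjecture on curves SEMISTABLE AWAY FROM `S` with two multiplicative primes** =
`ModularDegreeConjecture` (Pasten 2024 Conj. 3.2) restricted to the class of Pasten's Cor. 16.2: `E/ℚ` of conductor `N`
with `p² ∤ N` for every prime `p ∉ S` (semistable away from the finite set `S`) and at least two primes `p ∥ N`
(multiplicative reduction) — the rendering of `Literature.NumberTheory.DiophantineGeometry.pasten_valuationProduct_awayFrom`
(reduction types read off the conductor exponents, Silverman ATAEC IV.10.2). For `S = {2}` the class contains the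
Frey–Hellegouarch curves with two odd bad primes. OPEN; typed only as the target of the glue
`modularDegreeConjectureAwayFrom_of_shimuraDegreeConjecture` (modulo Thm 6.1 and Cor. 16.2); `ModularDegreeConjecture ⟹`
THIS is trivial. «NOT abc — POLY-SZPIRO(E)» reading on this class only. [cite: PastenShimura2024, Conj. 3.2 (§3, p. 13)
and Cor. 16.2 (§16.1, arXiv v4 p. 49)] [status: open] -/
@[conjecture] def ModularDegreeConjectureAwayFrom (S : Finset ℕ) : Prop :=
  ∃ K C : ℝ, ∀ (W : WeierstrassCurve ℚ) [W.IsElliptic] (N : ℕ) [NeZero N]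
    (D : ModularParametrizationData W N), W.conductorNorm ℤ = N →
    (∀ p : ℕ, p.Prime → p ∉ S → ¬ p ^ 2 ∣ N) →
    2 ≤ (N.primeFactors.filter (fun p => ¬ p ^ 2 ∣ N)).card →
    (∀ (W' : WeierstrassCurve ℚ) [W'.IsElliptic] (D' : ModularParametrizationData W' N),
        D'.f = D.f → D.modularDegree ≤ D'.modularDegree) →
      Real.log (D.modularDegree : ℝ) ≤ K * Real.log (N : ℝ) + C

/-- `ModularDegreeConjecture ⟹ ModularDegreeConjectureSemistable` (drop the extra binder; same constants). [folklore] -/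
theorem modularDegreeConjectureSemistable_of_modularDegreeConjecture (h : ModularDegreeConjecture) :
    ModularDegreeConjectureSemistable := by
  obtain ⟨K, C, hKC⟩ := h
  exact ⟨K, C, fun W _ N _ D hN _ hmin => hKC W N D hN hmin⟩

/-- `ModularDegreeConjecture ⟹ ModularDegreeConjectureAwayFrom S` (drop the extra binders; same constants). [folklore] -/
theorem modularDegreeConjectureAwayFrom_of_modularDegreeConjecture (h : ModularDegreeConjecture) (S : Finset ℕ) :
    ModularDegreeConjectureAwayFrom S := by
  obtain ⟨K, C, hKC⟩ := h
  exact ⟨K, C, fun W _ N _ D hN _ _ hmin => hKC W N D hN hmin⟩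

/-! ## Elementary inputs: admissible factorisations and the `ω(D)` bookkeeping -/

/-- For an admissible `N = D·M` (`D` squarefree, `gcd(D, M) = 1`) every prime `p ∣ D` divides `N` exactly once:
`p² ∤ N`. [folklore] -/
theorem not_sq_dvd_of_mem_primeFactors_of_isAdmissibleFactorization {N D M : ℕ}
    (hadm : IsAdmissibleFactorization N D M) {p : ℕ} (hp : p ∈ D.primeFactors) : ¬ p ^ 2 ∣ N := by
  intro h
  have hpP : p.Prime := Nat.prime_of_mem_primeFactors hp
  have hpD : p ∣ D := Nat.dvd_of_mem_primeFactors hp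
  have hcop : (p ^ 2).Coprime M := (Nat.Coprime.coprime_dvd_left hpD hadm.coprime).pow_left 2
  rw [← hadm.mul_eq] at h
  have h2 : p ^ 2 ∣ D := hcop.dvd_of_dvd_mul_right h
  exact hpP.not_isUnit (hadm.squarefree p (by simpa [sq] using h2))

/-- `ω(D)! ≤ N` for an admissible `N = D·M`: `ω(D)! ≤ ∏_{p∣D} p = D ≤ N` (`D` squarefree; tree
`card_factorial_le_prod`). [folklore] -/
theorem factorial_card_primeFactors_le_of_isAdmissibleFactorization {N D M : ℕ}
    (hadm : IsAdmissibleFactorization N D M) : (D.primeFactors.card)! ≤ N :=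
  calc (D.primeFactors.card)! ≤ ∏ p ∈ D.primeFactors, p :=
        card_factorial_le_prod _ fun _ hp => (Nat.prime_of_mem_primeFactors hp).one_le
    _ = D := Nat.prod_primeFactors_of_squarefree hadm.squarefree
    _ ≤ N := Nat.le_of_dvd hadm.pos (Dvd.intro M hadm.mul_eq)

/-- **`A·k ≤ η·log N + A·e^{A/η+1}` whenever `k! ≤ N`** (`A ≥ 0`, `η > 0`): the absorption `ω = o(log N)` with an
explicit constant. If `k ≤ e^{A/η+1}` this is clear; otherwise `log k > A/η + 1`, so `A·k ≤ η·(k log k − k) ≤ η·log k!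
≤ η·log N` by `k log k ≤ k + log k!` (`k^k/k! ≤ e^k`, tree `natCast_mul_log_le_of_pow_div_factorial`). [folklore] -/
theorem mul_natCast_le_mul_log_of_factorial_le {A η : ℝ} (hA : 0 ≤ A) (hη : 0 < η) {k N : ℕ}
    (hk : k ! ≤ N) : A * k ≤ η * Real.log N + A * Real.exp (A / η + 1) := by
  have hlogN : 0 ≤ Real.log N := Real.log_natCast_nonneg N
  have hexp : 0 < Real.exp (A / η + 1) := Real.exp_pos _
  rcases le_or_gt (k : ℝ) (Real.exp (A / η + 1)) with hkT | hkT
  · have h1 : A * k ≤ A * Real.exp (A / η + 1) := mul_le_mul_of_nonneg_left hkT hA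
    have h2 : 0 ≤ η * Real.log N := mul_nonneg hη.le hlogN
    linarith
  · have hk0 : (0 : ℝ) < k := hexp.trans hkT
    have hlogk : A / η + 1 < Real.log k := by
      rw [← Real.exp_lt_exp, Real.exp_log hk0]
      exact hkT
    have hA' : A < η * (Real.log k - 1) := by
      have h := (div_lt_iff₀ hη).mp (show A / η < Real.log k - 1 by linarith)
      linarith
    have hfac := natCast_mul_log_le_of_pow_div_factorial k (t := k) (θ := 1) hk0.le one_pos le_rfl
    rw [one_mul, div_one, Real.log_one, mul_zero, add_zero] at hfac
    have hfacN : Real.log (k ! : ℝ) ≤ Real.log N :=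
      Real.log_le_log (by positivity) (by exact_mod_cast hk)
    have h1 : A * k ≤ η * (Real.log k - 1) * k := mul_le_mul_of_nonneg_right hA'.le hk0.le
    have h2 : η * (Real.log k - 1) * k = η * ((k : ℝ) * Real.log k - k) := by ring
    rw [h2] at h1
    have h3 : η * ((k : ℝ) * Real.log k - k) ≤ η * Real.log (k ! : ℝ) :=
      mul_le_mul_of_nonneg_left (by linarith) hη.le
    have h4 : η * Real.log (k ! : ℝ) ≤ η * Real.log N := mul_le_mul_of_nonneg_left hfacN hη.le
    have h5 : 0 ≤ A * Real.exp (A / η + 1) := mul_nonneg hA hexp.le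
    linarith

/-! ## Elementary inputs: the valuation products `∏ v_p(Δ_min)` -/

/-- `v_p(Δ_min(E)) ≥ 1` for every prime `p ∣ N_E` (any model `W` of `E`; `N_E ∣ Δ_min(E)`, tree
`WeierstrassCurve.conductorNorm_dvd_minimalDiscriminantNorm` on the discharged finiteness fact). [folklore] -/
theorem one_le_factorization_minimalDiscriminantNorm (W : WeierstrassCurve ℚ) [W.IsElliptic] {N : ℕ}
    (hN : W.conductorNorm ℤ = N) {p : ℕ} (hp : p ∈ N.primeFactors) :
    1 ≤ (W.minimalDiscriminantNorm ℤ).factorization p := by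
  have hΔpos : 0 < W.minimalDiscriminantNorm ℤ := minimalDiscriminantNorm_pos_holds W
  have hNΔ : W.conductorNorm ℤ ∣ W.minimalDiscriminantNorm ℤ :=
    WeierstrassCurve.conductorNorm_dvd_minimalDiscriminantNorm W
      (WeierstrassCurve.finite_setOf_ordMinimalDiscriminant_ne_zero_holds W)
  rw [hN] at hNΔ
  exact (Nat.prime_of_mem_primeFactors hp).factorization_pos_of_dvd hΔpos.ne'
    ((Nat.dvd_of_mem_primeFactors hp).trans hNΔ)

/-- `∏_{p∣D} v_p(Δ_min(E)) ≤ ∏_{p ∥ N_E} v_p(Δ_min(E))` for an admissible `N_E = D·M` (every `p ∣ D` has `p ∥ N_E`,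
`not_sq_dvd_of_mem_primeFactors_of_isAdmissibleFactorization`; the extra factors are `≥ 1`). The right side is the
product of Pasten's Cor. 16.2 over the multiplicative primes `N_E^*`. [folklore] -/
theorem prod_primeFactors_factorization_le_prod_filter (W : WeierstrassCurve ℚ) [W.IsElliptic] {N D M : ℕ}
    (hN : W.conductorNorm ℤ = N) (hadm : IsAdmissibleFactorization N D M) :
    ∏ p ∈ D.primeFactors, (W.minimalDiscriminantNorm ℤ).factorization p ≤
      ∏ p ∈ N.primeFactors with ¬ p ^ 2 ∣ N, (W.minimalDiscriminantNorm ℤ).factorization p := by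
  refine Finset.prod_le_prod_of_subset_of_one_le' (fun _ hp => ?_) fun _ hp _ =>
    one_le_factorization_minimalDiscriminantNorm W hN (Finset.mem_filter.mp hp).1
  exact Finset.mem_filter.mpr ⟨Nat.primeFactors_mono (Dvd.intro M hadm.mul_eq) hadm.pos.ne' hp,
    not_sq_dvd_of_mem_primeFactors_of_isAdmissibleFactorization hadm hp⟩

/-- `∏_{p ∥ N_E} v_p(Δ_min(E)) ≤ ∏_{p∣N_E} v_p(Δ_min(E))` (the extra factors are `≥ 1`); the right side is the product
of Pasten's Thm 1.12 (`valuationProduct`). [folklore] -/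
theorem prod_filter_factorization_le_prod (W : WeierstrassCurve ℚ) [W.IsElliptic] {N : ℕ}
    (hN : W.conductorNorm ℤ = N) :
    ∏ p ∈ N.primeFactors with ¬ p ^ 2 ∣ N, (W.minimalDiscriminantNorm ℤ).factorization p ≤
      ∏ p ∈ N.primeFactors, (W.minimalDiscriminantNorm ℤ).factorization p :=
  Finset.prod_le_prod_of_subset_of_one_le' (Finset.filter_subset _ _) fun _ hp _ =>
    one_le_factorization_minimalDiscriminantNorm W hN hp

/-! ## The chain for one curve: (EqUpperRT) with the `∏ v_p` factor bounded -/

/-- **(EqUpperRT) with a bound `V` on `∏_{p∣D} v_p(Δ_E)`, for ONE globally minimal curve.** Let `W` be a global minimal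
model of `E/ℚ` of conductor `N`, `D₁` a class-minimal classical datum at level `N` with the newform of `W` (so
`D₁.modularDegree = δ_{1,N}(E)`), `N = D·M` admissible, `X` a Shimura curve datum of level `(D, M)`, `P` a datum on `X`
realising `δ_{D,M}(E)` (`P.IsMinimalFor W`) with `log P.deg ≤ B`, and `∏_{p∣D} v_p(Δ_E) ≤ V`. Then for every `η > 0`:
`log δ_{1,N}(E) ≤ B + log V + η·log N + 5.1·e^{5.1/η+1}`. Proof: Pasten's (EqUpperRT) `log δ_{1,N} ≤ log δ_{D,M} +
log ∏_{p∣D} v_p(Δ_E) + 5.1·ω(D)` (`PastenShimura2024_thm_6_1.log_le h61`; `5.1 ≥ log 163`) and `5.1·ω(D) ≤ η log N +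
5.1 e^{5.1/η+1}` from `ω(D)! ≤ N` (`mul_natCast_le_mul_log_of_factorial_le`). Hypothesis `h61` = Pasten's refined
Ribet–Takahashi formula (Thm 6.1, numerator of `γ_{D,M,E}` at most `163^{ω(D)}`).
[cite: PastenShimura2024, Thm. 6.1 p. 20 ((EqUpperRT))] -/
theorem log_modularDegree_le_of_log_shimuraDegree_le (h61 : PastenShimura2024_thm_6_1)
    (W : WeierstrassCurve ℚ) [W.IsElliptic] [W.IsGloballyMinimal] {N : ℕ} [NeZero N]
    (hN : W.conductorNorm ℤ = N) {W₁ : WeierstrassCurve ℚ} [W₁.IsElliptic]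
    (D₁ : ModularParametrizationData W₁ N) (hf : IsNewformOf W D₁.f)
    (hmin : ∀ (W₂ : WeierstrassCurve ℚ) [W₂.IsElliptic] (D₂ : ModularParametrizationData W₂ N),
      D₂.f = D₁.f → D₁.modularDegree ≤ D₂.modularDegree)
    {D M : ℕ} (hadm : IsAdmissibleFactorization N D M) (X : ShimuraCurveData D M)
    {W' : WeierstrassCurve ℚ} [W'.IsElliptic] (P : ShimuraParametrizationData X W')
    (hP : P.IsMinimalFor W) {B V η : ℝ} (hdeg : Real.log (P.deg : ℝ) ≤ B)
    (hV : ((∏ p ∈ D.primeFactors, (W.minimalDiscriminantNorm ℤ).factorization p : ℕ) : ℝ) ≤ V)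
    (hη : 0 < η) :
    Real.log (D₁.modularDegree : ℝ) ≤
      B + Real.log V + η * Real.log (N : ℝ) + 5.1 * Real.exp (5.1 / η + 1) := by
  have hRT := PastenShimura2024_thm_6_1.log_le h61 hadm X W hN W₁ D₁ hf hmin W' P hP
  have hPv1 : 1 ≤ ∏ p ∈ D.primeFactors, (W.minimalDiscriminantNorm ℤ).factorization p :=
    Finset.one_le_prod' fun _ hp => one_le_factorization_minimalDiscriminantNorm W hN
      (Nat.primeFactors_mono (Dvd.intro M hadm.mul_eq) hadm.pos.ne' hp)
  have hPv0 : (0 : ℝ) < ((∏ p ∈ D.primeFactors, (W.minimalDiscriminantNorm ℤ).factorization p : ℕ) : ℝ) := by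
    exact_mod_cast hPv1
  have hlogV := Real.log_le_log hPv0 hV
  have hω := mul_natCast_le_mul_log_of_factorial_le (A := 5.1) (by norm_num) hη
    (factorial_card_primeFactors_le_of_isAdmissibleFactorization hadm)
  linarith

/-! ## G-28: the Shimura door gives the modular-degree door on semistable curves -/

/-- **EFFECTIVE G-28 (PROVED MODULO TWO NAMED FACTS): `δ_{D,M}(E) ≤ e^C N_E^K` for one admissible `(D, M)` per curve
⟹ `δ_{1,N}(E) ≤ e^{C'} N_E^{K + 11/2 + ε}` for every SEMISTABLE `E/ℚ`** (every `ε > 0`; `C' = C + log K_{ε/2} +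
5.1·e^{10.2/ε+1}` with `K_{ε/2}` the constant of Thm 1.12). Hypotheses: `h61` = Pasten's Thm 6.1 (refined Ribet–Takahashi:
numerator of `γ_{D,M,E}` at most `163^{ω(D)}`), `h112` = Pasten's Thm 1.12 FIRST DISPLAY, `∏_{p∣N_E} v_p(Δ_E) < K_ε
N_E^{11/2+ε}` for semistable `E` (`Literature.NumberTheory.DiophantineGeometry.pasten_valuationProduct_semistable`, the
verbatim vendoring); `h` = the body of `ShimuraDegreeConjecture` with constants `(K, C)`. Proof: pass to a global minimal
model `C₁ • W` (conductor, `Δ_min`, isogeny class and newform are model invariants: `conductorNorm_smul_rat`,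
`minimalDiscriminantNorm_smul_rat`, `IsNewformOf.of_isIsogenous`), take the door's datum `P` for `C₁ • W`, and run
`log_modularDegree_le_of_log_shimuraDegree_le` with `V = K_{ε/2} N^{11/2+ε/2}` (`∏_{p∣D} ≤ ∏_{p∣N}`,
`prod_primeFactors_factorization_le_prod_filter`, `prod_filter_factorization_le_prod`) and `η = ε/2`. LOSS: `K ↦ K +
11/2 + ε`. «NOT abc — POLY-SZPIRO(E)» downstream only. [cite: PastenShimura2024, Thm. 6.1 p. 20 ((EqUpperRT)) and
Thm. 1.12 (arXiv v4 p. 8) = Thm. 16.5 (p. 50)] -/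
theorem exists_log_modularDegree_le_of_shimuraDegree_semistable
    (h61 : PastenShimura2024_thm_6_1) (h112 : pasten_valuationProduct_semistable) {K C : ℝ}
    (h : ∀ (W : WeierstrassCurve ℚ) [W.IsElliptic],
      ∃ (D M : ℕ) (X : ShimuraCurveData D M) (W' : WeierstrassCurve ℚ) (_ : W'.IsElliptic)
        (P : ShimuraParametrizationData X W'),
        IsAdmissibleFactorization (W.conductorNorm ℤ) D M ∧ P.IsMinimalFor W ∧
          Real.log (P.deg : ℝ) ≤ K * Real.log (W.conductorNorm ℤ : ℝ) + C)
    {ε : ℝ} (hε : 0 < ε) :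
    ∃ C' : ℝ, ∀ (W : WeierstrassCurve ℚ) [W.IsElliptic] (N : ℕ) [NeZero N]
      (D₁ : ModularParametrizationData W N), W.conductorNorm ℤ = N → W.IsSemistable ℤ →
      (∀ (W₂ : WeierstrassCurve ℚ) [W₂.IsElliptic] (D₂ : ModularParametrizationData W₂ N),
          D₂.f = D₁.f → D₁.modularDegree ≤ D₂.modularDegree) →
        Real.log (D₁.modularDegree : ℝ) ≤ (K + 11 / 2 + ε) * Real.log (N : ℝ) + C' := by
  obtain ⟨K₁, hK₁, h1⟩ := h112 (ε / 2) (half_pos hε)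
  refine ⟨C + Real.log K₁ + 5.1 * Real.exp (5.1 / (ε / 2) + 1), ?_⟩
  intro W _ N _ D₁ hN hss hmin
  -- a global minimal model `C₁ • W`: same conductor, same `Δ_min`, same newform
  obtain ⟨C₁, hC₁⟩ := hasGlobalMinimalModel_rat_holds W
  haveI := hC₁
  have hN₁ : (C₁ • W).conductorNorm ℤ = N := (conductorNorm_smul_rat W C₁).trans hN
  have hΔ : (C₁ • W).minimalDiscriminantNorm ℤ = W.minimalDiscriminantNorm ℤ :=
    minimalDiscriminantNorm_smul_rat W C₁
  have hnew : IsNewformOf (C₁ • W) D₁.f :=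
    D₁.isNewformOf.of_isIsogenous (WeierstrassCurve.isIsogenous_of_smul W C₁)
  -- the door's datum for `C₁ • W`
  obtain ⟨D, M, X, W', hW', P, hadm, hP, hdeg⟩ := h (C₁ • W)
  haveI := hW'
  rw [hN₁] at hadm hdeg
  -- Thm 1.12 at `ε/2` for the semistable `W`, and `∏_{p∣D} ≤ ∏_{p∣N}`
  have hvp := h1 W hss
  rw [valuationProduct_def, hN] at hvp
  have hNpos : (0 : ℝ) < N := by exact_mod_cast hadm.pos
  have hV : ((∏ p ∈ D.primeFactors, ((C₁ • W).minimalDiscriminantNorm ℤ).factorization p : ℕ) : ℝ)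
      ≤ K₁ * (N : ℝ) ^ ((11 : ℝ) / 2 + ε / 2) := by
    rw [hΔ]
    refine le_trans ?_ hvp.le
    exact_mod_cast (prod_primeFactors_factorization_le_prod_filter W hN hadm).trans
      (prod_filter_factorization_le_prod W hN)
  have hcore := log_modularDegree_le_of_log_shimuraDegree_le h61 (C₁ • W) hN₁ D₁ hnew hmin hadm X P hP
    hdeg hV (half_pos hε)
  rw [Real.log_mul hK₁.ne' (by positivity), Real.log_rpow hNpos] at hcore
  have hlN : 0 ≤ Real.log (N : ℝ) := Real.log_natCast_nonneg N
  linarith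

/-- **§GLUE LEDGER G-28 from the verbatim first display of Thm 1.12**: `ShimuraDegreeConjecture ⟹
ModularDegreeConjectureSemistable` modulo `h61` (Thm 6.1) and
`Literature.NumberTheory.DiophantineGeometry.pasten_valuationProduct_semistable` (Thm 1.12, first display only) — the
weakest pair of named facts the chain uses (`exists_log_modularDegree_le_of_shimuraDegree_semistable` at `ε = 1`).
«NOT abc — POLY-SZPIRO(E)». [cite: PastenShimura2024, Thm. 6.1 p. 20 and Thm. 1.12] -/
theorem modularDegreeConjectureSemistable_of_shimuraDegreeConjecture_of_valuationProduct
    (h61 : PastenShimura2024_thm_6_1) (h112 : pasten_valuationProduct_semistable)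
    (h : ShimuraDegreeConjecture) : ModularDegreeConjectureSemistable := by
  obtain ⟨K, C, hKC⟩ := h
  obtain ⟨C', hC'⟩ := exists_log_modularDegree_le_of_shimuraDegree_semistable h61 h112 hKC one_pos
  exact ⟨K + 11 / 2 + 1, C', hC'⟩

/-- **§GLUE LEDGER G-28 (PROVED MODULO TWO NAMED FACTS): the Shimura-degree door ⟹ the modular-degree door ON
SEMISTABLE CURVES — `ShimuraDegreeConjecture ⟹ ModularDegreeConjectureSemistable`**, with loss `K ↦ K + 11/2 + ε` (any
`ε > 0`; the `∃ K C` statement takes `ε = 1`). Hypotheses (displayed, none silent): `h61` = Pasten's refined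
Ribet–Takahashi formula Thm 6.1 (`Literature.NumberTheory.Automorphic.PastenShimura2024_thm_6_1`), consumed through its
tree-PROVED printed form (EqUpperRT) `PastenShimura2024_thm_6_1.log_le`; `h112` = Pasten's Thm 1.12 / 16.5
(`Literature.NumberTheory.EllipticCurves.pasten_thm_1_12`), of which ONLY the first display (Thm 1.12 verbatim:
`∏_{p∣N_E} v_p(Δ_E) < K_ε N_E^{11/2+ε}` for semistable `E`) is used, via the tree-PROVED projection
`pasten_valuationProduct_semistable_of_pasten_thm_1_12` (the second display carries an ERRATUM in the fact's docstring
and is NOT relied on). Together with the converse for ALL curves, `shimuraDegreeConjecture_of_modularDegreeConjecture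
(hmod)` (`GlueShimura.lean`: the `D = 1` door is the `(1, N)`-instance), this certifies director-abc g7-D2 (2): door C3
(SHIMURA, O-66) and the MODULAR-DEGREE door are the SAME WALL at rung A-PS on semistable curves; the all-`E` equivalence is
NOT claimed (additive places: `∏_{p∣D} v_p(Δ_E)` uncontrolled in print). «NOT abc — POLY-SZPIRO(E)»; PROVED-MOD-FACTS ≠
proved; abc is not proved by any of this. [cite: PastenShimura2024, Thm. 6.1 p. 20 ((EqUpperRT)), Thm. 1.12 (arXiv v4
p. 8) = Thm. 16.5 (p. 50), Conj. 3.2 (§3 p. 13)] -/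
theorem modularDegreeConjectureSemistable_of_shimuraDegreeConjecture
    (h61 : PastenShimura2024_thm_6_1) (h112 : pasten_thm_1_12) (h : ShimuraDegreeConjecture) :
    ModularDegreeConjectureSemistable :=
  modularDegreeConjectureSemistable_of_shimuraDegreeConjecture_of_valuationProduct h61
    (pasten_valuationProduct_semistable_of_pasten_thm_1_12 h112) h

/-! ## The same wall on curves semistable away from `S` (Cor. 16.2 in place of Thm 1.12) -/

/-- **EFFECTIVE VARIANT (PROVED MODULO TWO NAMED FACTS): the Shimura door gives `δ_{1,N}(E) ≤ e^{C'} N_E^{K+11/2+ε}`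
for every `E/ℚ` semistable away from `S` with at least two multiplicative primes** (`C' = C + log K_{S,ε/2} +
5.1·e^{10.2/ε+1}`). Hypotheses: `h61` (Thm 6.1) and `h162` = Pasten's Cor. 16.2 in the constant form
`Literature.NumberTheory.DiophantineGeometry.pasten_valuationProduct_awayFrom` (`∏_{p ∥ N_E} v_p(Δ_E) < K_{S,ε}
N_E^{11/2+ε}`); the primes of `D` are among the `p ∥ N_E` (`prod_primeFactors_factorization_le_prod_filter`).
«NOT abc — POLY-SZPIRO(E)» on this class only. [cite: PastenShimura2024, Thm. 6.1 p. 20 and Cor. 16.2 (arXiv v4 p. 49)] -/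
theorem exists_log_modularDegree_le_of_shimuraDegree_awayFrom
    (h61 : PastenShimura2024_thm_6_1) (h162 : pasten_valuationProduct_awayFrom) {K C : ℝ}
    (h : ∀ (W : WeierstrassCurve ℚ) [W.IsElliptic],
      ∃ (D M : ℕ) (X : ShimuraCurveData D M) (W' : WeierstrassCurve ℚ) (_ : W'.IsElliptic)
        (P : ShimuraParametrizationData X W'),
        IsAdmissibleFactorization (W.conductorNorm ℤ) D M ∧ P.IsMinimalFor W ∧
          Real.log (P.deg : ℝ) ≤ K * Real.log (W.conductorNorm ℤ : ℝ) + C)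
    (S : Finset ℕ) {ε : ℝ} (hε : 0 < ε) :
    ∃ C' : ℝ, ∀ (W : WeierstrassCurve ℚ) [W.IsElliptic] (N : ℕ) [NeZero N]
      (D₁ : ModularParametrizationData W N), W.conductorNorm ℤ = N →
      (∀ p : ℕ, p.Prime → p ∉ S → ¬ p ^ 2 ∣ N) →
      2 ≤ (N.primeFactors.filter (fun p => ¬ p ^ 2 ∣ N)).card →
      (∀ (W₂ : WeierstrassCurve ℚ) [W₂.IsElliptic] (D₂ : ModularParametrizationData W₂ N),
          D₂.f = D₁.f → D₁.modularDegree ≤ D₂.modularDegree) →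
        Real.log (D₁.modularDegree : ℝ) ≤ (K + 11 / 2 + ε) * Real.log (N : ℝ) + C' := by
  obtain ⟨K₁, hK₁, h1⟩ := h162 S (ε / 2) (half_pos hε)
  refine ⟨C + Real.log K₁ + 5.1 * Real.exp (5.1 / (ε / 2) + 1), ?_⟩
  intro W _ N _ D₁ hN hS h2 hmin
  obtain ⟨C₁, hC₁⟩ := hasGlobalMinimalModel_rat_holds W
  haveI := hC₁
  have hN₁ : (C₁ • W).conductorNorm ℤ = N := (conductorNorm_smul_rat W C₁).trans hN
  have hΔ : (C₁ • W).minimalDiscriminantNorm ℤ = W.minimalDiscriminantNorm ℤ :=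
    minimalDiscriminantNorm_smul_rat W C₁
  have hnew : IsNewformOf (C₁ • W) D₁.f :=
    D₁.isNewformOf.of_isIsogenous (WeierstrassCurve.isIsogenous_of_smul W C₁)
  obtain ⟨D, M, X, W', hW', P, hadm, hP, hdeg⟩ := h (C₁ • W)
  haveI := hW'
  rw [hN₁] at hadm hdeg
  -- Cor. 16.2 at `ε/2` for `W`, and `∏_{p∣D} ≤ ∏_{p ∥ N}`
  have hvp := h1 W (by rw [hN]; exact hS) (by rw [hN]; exact h2)
  rw [hN] at hvp
  have hNpos : (0 : ℝ) < N := by exact_mod_cast hadm.pos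
  have hV : ((∏ p ∈ D.primeFactors, ((C₁ • W).minimalDiscriminantNorm ℤ).factorization p : ℕ) : ℝ)
      ≤ K₁ * (N : ℝ) ^ ((11 : ℝ) / 2 + ε / 2) := by
    rw [hΔ]
    refine le_trans ?_ hvp.le
    exact_mod_cast prod_primeFactors_factorization_le_prod_filter W hN hadm
  have hcore := log_modularDegree_le_of_log_shimuraDegree_le h61 (C₁ • W) hN₁ D₁ hnew hmin hadm X P hP
    hdeg hV (half_pos hε)
  rw [Real.log_mul hK₁.ne' (by positivity), Real.log_rpow hNpos] at hcore
  have hlN : 0 ≤ Real.log (N : ℝ) := Real.log_natCast_nonneg N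
  linarith

/-- **VARIANT OF G-28 (PROVED MODULO TWO NAMED FACTS): `ShimuraDegreeConjecture ⟹ ModularDegreeConjectureAwayFrom S`
for every finite set of primes `S`**, with loss `K ↦ K + 11/2 + ε` — Pasten's Cor. 16.2 (`h162 =
Literature.NumberTheory.EllipticCurves.pasten_cor_16_2`, places/threshold rendering, identified with the constant form by
the tree-PROVED `pasten_cor_16_2_iff_pasten_valuationProduct_awayFrom`, Shafarevich's theorem absorbing the finitely many
exceptions) in place of Thm 1.12. For `S = {2}` this puts the two doors on one wall along the Frey–Hellegouarch curves
with two odd bad primes. «NOT abc — POLY-SZPIRO(E)» on this class only; the all-`E` statement is NOT claimed.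
[cite: PastenShimura2024, Thm. 6.1 p. 20 and Cor. 16.2 (arXiv v4 p. 49)] -/
theorem modularDegreeConjectureAwayFrom_of_shimuraDegreeConjecture
    (h61 : PastenShimura2024_thm_6_1) (h162 : pasten_cor_16_2) (h : ShimuraDegreeConjecture)
    (S : Finset ℕ) : ModularDegreeConjectureAwayFrom S := by
  obtain ⟨K, C, hKC⟩ := h
  obtain ⟨C', hC'⟩ := exists_log_modularDegree_le_of_shimuraDegree_awayFrom h61
    (pasten_cor_16_2_iff_pasten_valuationProduct_awayFrom.mp h162) hKC S one_pos
  exact ⟨K + 11 / 2 + 1, C', hC'⟩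

end Summit.ABC.Harvest

end
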